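import Summits.RiemannHypothesis.RiemannHypothesis.Theorems.MotivicDoorAWSWindowBounds

/-!
# AWS sprint, TEST-CLASS-DOWN (2/3): the Dirichlet energy, the `L²` norm and the masses

HONEST LABEL.  One-way implication from a strengthened, prime-side-only axiom system; the existence
of an `ArithmeticWeilSurface` is NOT claimed and is the located gap.  SATISFIABILITY OF THE AXIOM LIST
IS EQUIVALENT TO RH (kernel form for Gram-data carriers: `riemannHypothesis_iff_exists_tautologicalCarrier`,
`Theorems/MotivicDoor/AWS/Tautological.lean`; for this structure: the free lattice on the tautological
generating family, DERIVED in `AWS-DESIGN.md` §8) — forward direction by forcing; the structure is a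
REFORMULATION isolating the sign condition `hodge` (which, with the three prime-side identities, already
says "Weil positivity on the real span of the generating family"), not a weaker or different hypothesis.
(This supersedes the earlier clause "the converse is not expected to be provable".)  Framing: lottery
ticket at the motivic door; RH probability negligible; consolation prizes are real: a new semi-local
Weil-positivity theorem, or a located gap in the Connes–Consani programme, plus the ff-door theorem.

Upper bounds and `λ`-continuity for the Dirichlet energy `𝓔_R` of the Markov form, for `‖g‖₂²`,
and window bounds for the Mellin values `d⋆(f) = ĝ(0)`, `d_u(f) = ĝ(1)` (L2, L5, L6 of the
forcing-down plan).  No zeros of `ζ` are used.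
-/

noncomputable section

open Complex Set MeasureTheory Filter Literature.NumberTheory.LFunctions
open Literature.NumberTheory.ConnesConsani2019
open Summit.RiemannHypothesis.RiemannHypothesis.Theorems.MotivicDoor.ConnesConsani
open scoped BigOperators Real ArithmeticFunction.vonMangoldt

namespace Summit.RiemannHypothesis.RiemannHypothesis.Theorems.MotivicDoor.AWS


/-! ## The Dirichlet energy: upper bound and `λ`-continuity (L5) -/

/-- On `(0, 1]`: `w(t) · t² ≤ 1` (from `w(t) ≤ e^{t/2}/(2t)` and `e^{1/2} ≤ 2`). -/
theorem weilArchDensity_mul_sq_le_one {t : ℝ} (ht : 0 < t) (ht1 : t ≤ 1) :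
    weilArchDensity t * t ^ 2 ≤ 1 := by
  have h := weilArchDensity_le_exp_half_div ht
  have hexp : Real.exp (t / 2) ≤ 2 := by
    have h1 : Real.exp (t / 2) ≤ Real.exp (1 / 2) := Real.exp_le_exp.2 (by linarith)
    have h2 : Real.exp (1 / 2) ≤ 2 := by
      have := Real.exp_one_lt_d9
      have h3 : Real.exp (1 / 2) ^ 2 = Real.exp 1 := by
        rw [← Real.exp_nat_mul]; norm_num
      nlinarith [Real.exp_pos (1 / 2 : ℝ)]
    exact h1.trans h2
  calc weilArchDensity t * t ^ 2 ≤ Real.exp (t / 2) / (2 * t) * t ^ 2 := by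
        gcongr
    _ = Real.exp (t / 2) * t / 2 := by field_simp
    _ ≤ 2 * 1 / 2 := by gcongr
    _ = 1 := by norm_num

/-- **Energy upper bound**: for a real test function `g` with `tsupport g ⊆ [-R, R]` (`R > 0`),
`|g| ≤ S`, `|g'| ≤ S'`:
`𝓔_R(g) ≤ 8 R S² (Σ_{n ∈ weilPrimeIndex R} Λ(n)/√n + ∫_{(1,∞)} w) + (2R + 2) S'²`. -/
theorem weilDirichletEnergy_le_of_bounds {g : ℝ → ℝ} (hg : IsWeilTest fun t ↦ (g t : ℂ)) {R S S' : ℝ}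
    (hR : 0 < R) (hsupp : tsupport g ⊆ Icc (-R) R) (hbd : ∀ x, |g x| ≤ S)
    (hder : ∀ x, |deriv g x| ≤ S') :
    weilDirichletEnergy R (fun t ↦ (g t : ℂ)) ≤
      8 * R * S ^ 2 * ((∑ n ∈ weilPrimeIndex R, (Λ n : ℝ) / Real.sqrt n) +
        ∫ t in Ioi (1 : ℝ), weilArchDensity t) + (2 * R + 2) * S' ^ 2 := by
  have hcrude : ∀ t, weilIncrement (fun x ↦ (g x : ℂ)) t ≤ 8 * R * S ^ 2 :=
    weilIncrement_le_of_abs_le hg hR.le hsupp hbd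
  have hlip : ∀ t, weilIncrement (fun x ↦ (g x : ℂ)) t ≤ (S' * t) ^ 2 * (2 * R + 2 * |t|) :=
    weilIncrement_le_of_deriv_le hg hR.le hsupp hder
  -- prime part
  have hprime : ∑ n ∈ weilPrimeIndex R, (Λ n : ℝ) / Real.sqrt n *
      weilIncrement (fun x ↦ (g x : ℂ)) (Real.log n) ≤
      ∑ n ∈ weilPrimeIndex R, (Λ n : ℝ) / Real.sqrt n * (8 * R * S ^ 2) :=
    Finset.sum_le_sum fun n _ ↦ mul_le_mul_of_nonneg_left (hcrude _) (div_nonneg ArithmeticFunction.vonMangoldt_nonneg (Real.sqrt_nonneg _))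
  rw [← Finset.sum_mul] at hprime
  -- archimedean part: split at `t = 1`
  have hint := integrableOn_weilArchDensity_mul_weilIncrement hg
  have hsplit : ∫ t in Ioi (0 : ℝ), weilArchDensity t * weilIncrement (fun x ↦ (g x : ℂ)) t =
      (∫ t in Ioc (0 : ℝ) 1, weilArchDensity t * weilIncrement (fun x ↦ (g x : ℂ)) t) +
        ∫ t in Ioi (1 : ℝ), weilArchDensity t * weilIncrement (fun x ↦ (g x : ℂ)) t := by
    rw [← Ioc_union_Ioi_eq_Ioi zero_le_one,
      setIntegral_union (Ioc_disjoint_Ioi le_rfl) measurableSet_Ioi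
        (hint.mono_set Ioc_subset_Ioi_self) (hint.mono_set (Ioi_subset_Ioi zero_le_one))]
  have hnonneg : ∀ t, 0 < t → 0 ≤ weilArchDensity t * weilIncrement (fun x ↦ (g x : ℂ)) t :=
    fun t ht ↦ mul_nonneg (weilArchDensity_pos ht).le (weilIncrement_nonneg _ _)
  -- small `t`
  have hsmall : ∫ t in Ioc (0 : ℝ) 1, weilArchDensity t * weilIncrement (fun x ↦ (g x : ℂ)) t ≤
      ∫ t in Ioc (0 : ℝ) 1, (2 * R + 2) * S' ^ 2 := by
    refine setIntegral_mono_on (hint.mono_set Ioc_subset_Ioi_self) (integrableOn_const (by simp))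
      measurableSet_Ioc fun t ht ↦ ?_
    have ht0 : 0 < t := ht.1
    have ht1 : t ≤ 1 := ht.2
    calc weilArchDensity t * weilIncrement (fun x ↦ (g x : ℂ)) t
        ≤ weilArchDensity t * ((S' * t) ^ 2 * (2 * R + 2 * |t|)) :=
          mul_le_mul_of_nonneg_left (hlip t) (weilArchDensity_pos ht0).le
      _ = (weilArchDensity t * t ^ 2) * (S' ^ 2 * (2 * R + 2 * |t|)) := by ring
      _ ≤ 1 * (S' ^ 2 * (2 * R + 2 * 1)) := by
          rw [abs_of_pos ht0]
          exact mul_le_mul (weilArchDensity_mul_sq_le_one ht0 ht1) (by gcongr) (by positivity)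
            zero_le_one
      _ = (2 * R + 2) * S' ^ 2 := by ring
  have hsmall' : ∫ t in Ioc (0 : ℝ) 1, (2 * R + 2) * S' ^ 2 = (2 * R + 2) * S' ^ 2 := by
    rw [setIntegral_const, Real.volume_real_Ioc_of_le zero_le_one, smul_eq_mul]; ring
  -- large `t`
  have hlarge : ∫ t in Ioi (1 : ℝ), weilArchDensity t * weilIncrement (fun x ↦ (g x : ℂ)) t ≤
      ∫ t in Ioi (1 : ℝ), weilArchDensity t * (8 * R * S ^ 2) := by
    refine setIntegral_mono_on (hint.mono_set (Ioi_subset_Ioi zero_le_one))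
      ((integrableOn_weilArchDensity_Ioi one_pos).mul_const _) measurableSet_Ioi fun t ht ↦ ?_
    exact mul_le_mul_of_nonneg_left (hcrude t) (weilArchDensity_pos (lt_trans one_pos ht)).le
  rw [integral_mul_const] at hlarge
  unfold weilDirichletEnergy
  rw [hsplit]
  have hA : 0 ≤ ∫ t in Ioi (1 : ℝ), weilArchDensity t :=
    setIntegral_nonneg measurableSet_Ioi fun t ht ↦ (weilArchDensity_pos (lt_trans one_pos ht)).le
  nlinarith [hprime, hsmall, hsmall', hlarge, hA, sq_nonneg S, sq_nonneg S']

/-- **`λ`-continuity of the Dirichlet energy (L5)**: for real test functions `u, v` and `λ > 0`,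
`|𝓔_R(u) − 𝓔_R(v)| ≤ 𝓔_R(u − v)/λ + (λ/2)(𝓔_R(u) + 𝓔_R(v))`. -/
theorem abs_weilDirichletEnergy_sub_le {u v : ℝ → ℝ} (hu : IsWeilTest fun t ↦ (u t : ℂ))
    (hv : IsWeilTest fun t ↦ (v t : ℂ)) (R : ℝ) {lam : ℝ} (hlam : 0 < lam) :
    |weilDirichletEnergy R (fun t ↦ (u t : ℂ)) - weilDirichletEnergy R (fun t ↦ (v t : ℂ))| ≤
      weilDirichletEnergy R (fun t ↦ ((u t - v t : ℝ) : ℂ)) / lam +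
        lam / 2 * (weilDirichletEnergy R (fun t ↦ (u t : ℂ)) +
          weilDirichletEnergy R (fun t ↦ (v t : ℂ))) := by
  have hw := isWeilTest_sub_ofReal hu hv
  set Du : ℝ → ℝ := weilIncrement (fun x ↦ (u x : ℂ)) with hDu
  set Dv : ℝ → ℝ := weilIncrement (fun x ↦ (v x : ℂ)) with hDv
  set Dw : ℝ → ℝ := weilIncrement (fun x ↦ ((u x - v x : ℝ) : ℂ)) with hDw
  have hB : ∀ t, |Du t - Dv t| ≤ Dw t / lam + lam / 2 * (Du t + Dv t) :=
    fun t ↦ abs_weilIncrement_sub_le hu hv t hlam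
  have hiu := integrableOn_weilArchDensity_mul_weilIncrement hu
  have hiv := integrableOn_weilArchDensity_mul_weilIncrement hv
  have hiw := integrableOn_weilArchDensity_mul_weilIncrement hw
  -- prime part
  have hP : |(∑ n ∈ weilPrimeIndex R, (Λ n : ℝ) / Real.sqrt n * Du (Real.log n)) -
      ∑ n ∈ weilPrimeIndex R, (Λ n : ℝ) / Real.sqrt n * Dv (Real.log n)| ≤
      (∑ n ∈ weilPrimeIndex R, (Λ n : ℝ) / Real.sqrt n * Dw (Real.log n)) / lam +
        lam / 2 * ((∑ n ∈ weilPrimeIndex R, (Λ n : ℝ) / Real.sqrt n * Du (Real.log n)) +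
          ∑ n ∈ weilPrimeIndex R, (Λ n : ℝ) / Real.sqrt n * Dv (Real.log n)) := by
    rw [← Finset.sum_sub_distrib]
    calc |∑ n ∈ weilPrimeIndex R, ((Λ n : ℝ) / Real.sqrt n * Du (Real.log n) -
            (Λ n : ℝ) / Real.sqrt n * Dv (Real.log n))|
        ≤ ∑ n ∈ weilPrimeIndex R, |(Λ n : ℝ) / Real.sqrt n * Du (Real.log n) -
            (Λ n : ℝ) / Real.sqrt n * Dv (Real.log n)| := Finset.abs_sum_le_sum_abs _ _
      _ ≤ ∑ n ∈ weilPrimeIndex R, (Λ n : ℝ) / Real.sqrt n *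
            (Dw (Real.log n) / lam + lam / 2 * (Du (Real.log n) + Dv (Real.log n))) := by
          refine Finset.sum_le_sum fun n _ ↦ ?_
          rw [← mul_sub, abs_mul, abs_of_nonneg (div_nonneg ArithmeticFunction.vonMangoldt_nonneg (Real.sqrt_nonneg _))]
          exact mul_le_mul_of_nonneg_left (hB _) (div_nonneg ArithmeticFunction.vonMangoldt_nonneg (Real.sqrt_nonneg _))
      _ = _ := by
          rw [← Finset.sum_add_distrib, Finset.mul_sum, Finset.sum_div, ← Finset.sum_add_distrib]
          refine Finset.sum_congr rfl fun n _ ↦ ?_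
          ring
  -- archimedean part
  have hA : |(∫ t in Ioi (0 : ℝ), weilArchDensity t * Du t) -
      ∫ t in Ioi (0 : ℝ), weilArchDensity t * Dv t| ≤
      (∫ t in Ioi (0 : ℝ), weilArchDensity t * Dw t) / lam +
        lam / 2 * ((∫ t in Ioi (0 : ℝ), weilArchDensity t * Du t) +
          ∫ t in Ioi (0 : ℝ), weilArchDensity t * Dv t) := by
    rw [← integral_sub hiu hiv]
    have hm1 : IntegrableOn (fun t ↦ weilArchDensity t * Dw t / lam) (Ioi 0) := by
      exact hiw.div_const lam
    have hm2 : IntegrableOn (fun t ↦ lam / 2 * (weilArchDensity t * Du t + weilArchDensity t * Dv t))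
        (Ioi 0) := by
      exact (hiu.add hiv).const_mul (lam / 2)
    have hmaj : IntegrableOn (fun t ↦ weilArchDensity t * (Dw t / lam + lam / 2 * (Du t + Dv t)))
        (Ioi 0) := by
      refine (hm1.add hm2).congr (Eventually.of_forall fun t ↦ ?_)
      simp only [Pi.add_apply]
      ring
    calc |∫ t in Ioi (0 : ℝ), (weilArchDensity t * Du t - weilArchDensity t * Dv t)|
        ≤ ∫ t in Ioi (0 : ℝ), |weilArchDensity t * Du t - weilArchDensity t * Dv t| :=
          abs_integral_le_integral_abs
      _ ≤ ∫ t in Ioi (0 : ℝ), weilArchDensity t * (Dw t / lam + lam / 2 * (Du t + Dv t)) := by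
          refine setIntegral_mono_on (hiu.sub hiv).abs hmaj measurableSet_Ioi fun t ht ↦ ?_
          rw [← mul_sub, abs_mul, abs_of_pos (weilArchDensity_pos ht)]
          exact mul_le_mul_of_nonneg_left (hB t) (weilArchDensity_pos ht).le
      _ = _ := by
          have h1 : ∀ t, weilArchDensity t * (Dw t / lam + lam / 2 * (Du t + Dv t)) =
              (weilArchDensity t * Dw t) / lam + lam / 2 * (weilArchDensity t * Du t +
                weilArchDensity t * Dv t) := fun t ↦ by ring
          simp_rw [h1]
          rw [integral_add hm1 hm2, integral_div, integral_const_mul, integral_add hiu hiv]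
  unfold weilDirichletEnergy
  have hE : ∀ a b c d : ℝ, (a + b) - (c + d) = (a - c) + (b - d) := fun a b c d ↦ by ring
  rw [hE]
  calc |((∑ n ∈ weilPrimeIndex R, (Λ n : ℝ) / Real.sqrt n * Du (Real.log n)) -
          ∑ n ∈ weilPrimeIndex R, (Λ n : ℝ) / Real.sqrt n * Dv (Real.log n)) +
        ((∫ t in Ioi (0 : ℝ), weilArchDensity t * Du t) -
          ∫ t in Ioi (0 : ℝ), weilArchDensity t * Dv t)|
      ≤ |(∑ n ∈ weilPrimeIndex R, (Λ n : ℝ) / Real.sqrt n * Du (Real.log n)) -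
          ∑ n ∈ weilPrimeIndex R, (Λ n : ℝ) / Real.sqrt n * Dv (Real.log n)| +
        |(∫ t in Ioi (0 : ℝ), weilArchDensity t * Du t) -
          ∫ t in Ioi (0 : ℝ), weilArchDensity t * Dv t| := abs_add_le _ _
    _ ≤ _ := by
        have := add_le_add hP hA
        refine this.trans (le_of_eq ?_)
        ring

/-! ## The `L²` norm (L2) -/

/-- `‖g‖₂² = ∫ g²` for a real function. -/
theorem integral_norm_sq_ofReal_eq (g : ℝ → ℝ) : ∫ x, ‖(g x : ℂ)‖ ^ 2 = ∫ x, g x ^ 2 := by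
  congr 1; funext x; rw [Complex.norm_real, Real.norm_eq_abs, sq_abs]

/-- **`λ`-continuity of `‖·‖₂²` (L2)**. -/
theorem abs_integral_norm_sq_sub_le {u v : ℝ → ℝ} (hu : IsWeilTest fun t ↦ (u t : ℂ))
    (hv : IsWeilTest fun t ↦ (v t : ℂ)) {lam : ℝ} (hlam : 0 < lam) :
    |(∫ x, ‖(u x : ℂ)‖ ^ 2) - ∫ x, ‖(v x : ℂ)‖ ^ 2| ≤
      (∫ x, ‖((u x - v x : ℝ) : ℂ)‖ ^ 2) / lam +
        lam / 2 * ((∫ x, ‖(u x : ℂ)‖ ^ 2) + ∫ x, ‖(v x : ℂ)‖ ^ 2) := by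
  have hw := isWeilTest_sub_ofReal hu hv
  rw [integral_norm_sq_ofReal_eq u, integral_norm_sq_ofReal_eq v,
    integral_norm_sq_ofReal_eq (fun x ↦ u x - v x)]
  have hiu : Integrable fun x ↦ u x ^ 2 := by
    have := hu.integrable_norm_sq; rwa [show (fun x ↦ ‖(u x : ℂ)‖ ^ 2) = fun x ↦ u x ^ 2 from by
      funext x; rw [Complex.norm_real, Real.norm_eq_abs, sq_abs]] at this
  have hiv : Integrable fun x ↦ v x ^ 2 := by
    have := hv.integrable_norm_sq; rwa [show (fun x ↦ ‖(v x : ℂ)‖ ^ 2) = fun x ↦ v x ^ 2 from by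
      funext x; rw [Complex.norm_real, Real.norm_eq_abs, sq_abs]] at this
  have hiw : Integrable fun x ↦ (u x - v x) ^ 2 := by
    have := hw.integrable_norm_sq
    rwa [show (fun x ↦ ‖((u x - v x : ℝ) : ℂ)‖ ^ 2) = fun x ↦ (u x - v x) ^ 2 from by
      funext x; rw [Complex.norm_real, Real.norm_eq_abs, sq_abs]] at this
  rw [← integral_sub hiu hiv]
  have hm1 : Integrable fun x ↦ (u x - v x) ^ 2 / lam := by exact hiw.div_const lam
  have hm2 : Integrable fun x ↦ lam / 2 * (u x ^ 2 + v x ^ 2) := by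
    exact (hiu.add hiv).const_mul (lam / 2)
  calc |∫ x, (u x ^ 2 - v x ^ 2)| ≤ ∫ x, |u x ^ 2 - v x ^ 2| := abs_integral_le_integral_abs
    _ ≤ ∫ x, ((u x - v x) ^ 2 / lam + lam / 2 * (u x ^ 2 + v x ^ 2)) :=
        integral_mono (hiu.sub hiv).abs (hm1.add hm2) fun x ↦ abs_sq_sub_sq_le_div_add _ _ hlam
    _ = _ := by rw [integral_add hm1 hm2, integral_div, integral_const_mul, integral_add hiu hiv]

/-! ## The Mellin values / masses (L6) -/

/-- **Window bound for the Mellin transform on the closed critical strip**: if `|w| ≤ S`,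
`tsupport w ⊆ [-R, R]` (`R ≥ 0`) and `0 ≤ Re s ≤ 1`, then `|ŵ(s)| ≤ S e^{R/2} · 2R`. -/
theorem norm_weilMellin_ofReal_le {w : ℝ → ℝ} {R S : ℝ} (hR : 0 ≤ R)
    (hsupp : tsupport w ⊆ Icc (-R) R) (hS : 0 ≤ S) (hbd : ∀ x, |w x| ≤ S) {s : ℂ}
    (hs0 : 0 ≤ s.re) (hs1 : s.re ≤ 1) :
    ‖weilMellin (fun t ↦ (w t : ℂ)) s‖ ≤ S * Real.exp (R / 2) * (2 * R) := by
  unfold weilMellin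
  refine (norm_integral_le_integral_norm _).trans ?_
  have hpt : ∀ t, ‖(w t : ℂ) * cexp ((s - 1 / 2) * t)‖ ≤ S * Real.exp (R / 2) ∨
      t ∉ Icc (-R) R := by
    intro t
    by_cases ht : t ∈ Icc (-R) R
    · left
      rw [norm_mul, Complex.norm_real, Real.norm_eq_abs, Complex.norm_exp]
      have hre : ((s - 1 / 2) * (t : ℂ)).re = (s.re - 1 / 2) * t := by
        simp [Complex.mul_re]
      rw [hre]
      have h1 : (s.re - 1 / 2) * t ≤ R / 2 := by
        have : |(s.re - 1 / 2) * t| ≤ 1 / 2 * R := by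
          rw [abs_mul]
          exact mul_le_mul (abs_le.2 ⟨by linarith, by linarith⟩) (abs_le.2 ⟨ht.1, ht.2⟩)
            (abs_nonneg _) (by norm_num)
        linarith [le_abs_self ((s.re - 1 / 2) * t)]
      exact mul_le_mul (hbd t) (Real.exp_le_exp.2 h1) (Real.exp_pos _).le hS
    · right; exact ht
  have hF : ∀ t, ‖(w t : ℂ) * cexp ((s - 1 / 2) * t)‖ ≤ S * Real.exp (R / 2) := by
    intro t
    rcases hpt t with h | h
    · exact h
    · rw [eq_zero_of_tsupport_subset hsupp h]; simp; positivity
  have hzero : ∀ t, t ∉ Icc (-R) R → ‖(w t : ℂ) * cexp ((s - 1 / 2) * t)‖ = 0 := by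
    intro t ht
    rw [eq_zero_of_tsupport_subset hsupp ht]; simp
  calc ∫ t, ‖(w t : ℂ) * cexp ((s - 1 / 2) * t)‖ ≤ S * Real.exp (R / 2) * (R - -R) :=
        integral_le_of_eq_zero_off_Icc (by linarith) (by positivity) hF hzero
    _ = S * Real.exp (R / 2) * (2 * R) := by ring

/-- The masses of `toMul u` are the real Mellin values at `0` and `1`. -/
theorem massDstar_toMul_eq_re (u : ℝ → ℝ) :
    massDstar (toMul u) = (weilMellin (fun t ↦ (u t : ℂ)) 0).re := by
  rw [weilMellin_zero_eq_massDstar, Complex.ofReal_re]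

/-- `d_u(f_u) = Re û(1)` for a real test function `u`. -/
theorem massDu_toMul_eq_re (u : ℝ → ℝ) :
    massDu (toMul u) = (weilMellin (fun t ↦ (u t : ℂ)) 1).re := by
  rw [weilMellin_one_eq_massDu, Complex.ofReal_re]

/-- The Mellin transform of a difference of real test functions. -/
theorem weilMellin_ofReal_sub {u v : ℝ → ℝ} (hu : IsWeilTest fun t ↦ (u t : ℂ))
    (hv : IsWeilTest fun t ↦ (v t : ℂ)) (s : ℂ) :
    weilMellin (fun t ↦ ((u t - v t : ℝ) : ℂ)) s =
      weilMellin (fun t ↦ (u t : ℂ)) s - weilMellin (fun t ↦ (v t : ℂ)) s := by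
  rw [← weilMellin_sub hu.1.continuous hu.2 hv.1.continuous hv.2]
  congr 1
  funext t
  simp only [Pi.sub_apply]
  push_cast
  ring

/-- **Mass bounds (L6)**: `|d⋆(f_u)| ≤ S e^{R/2} 2R`, and the same for `d_u`, for `|u| ≤ S` on the
window. -/
theorem abs_massDstar_toMul_le {w : ℝ → ℝ} {R S : ℝ} (hR : 0 ≤ R)
    (hsupp : tsupport w ⊆ Icc (-R) R) (hS : 0 ≤ S) (hbd : ∀ x, |w x| ≤ S) :
    |massDstar (toMul w)| ≤ S * Real.exp (R / 2) * (2 * R) := by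
  rw [massDstar_toMul_eq_re]
  exact (Complex.abs_re_le_norm _).trans
    (norm_weilMellin_ofReal_le hR hsupp hS hbd (by simp) (by simp))

/-- Window bound for the mass `d_u(f_w)`: `|d_u| ≤ S e^{R/2} · 2R`. -/
theorem abs_massDu_toMul_le {w : ℝ → ℝ} {R S : ℝ} (hR : 0 ≤ R)
    (hsupp : tsupport w ⊆ Icc (-R) R) (hS : 0 ≤ S) (hbd : ∀ x, |w x| ≤ S) :
    |massDu (toMul w)| ≤ S * Real.exp (R / 2) * (2 * R) := by
  rw [massDu_toMul_eq_re]
  exact (Complex.abs_re_le_norm _).trans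
    (norm_weilMellin_ofReal_le hR hsupp hS hbd (by simp) (by simp))

/-- **Mass continuity**: `|d⋆(f_u) − d⋆(f_v)| ≤ ε e^{R/2} 2R` when `|u − v| ≤ ε` on the window;
likewise for `d_u`. -/
theorem abs_massDstar_toMul_sub_le {u v : ℝ → ℝ} (hu : IsWeilTest fun t ↦ (u t : ℂ))
    (hv : IsWeilTest fun t ↦ (v t : ℂ)) {R ε : ℝ} (hR : 0 ≤ R) (hsuppu : tsupport u ⊆ Icc (-R) R)
    (hsuppv : tsupport v ⊆ Icc (-R) R) (hε : 0 ≤ ε) (hclose : ∀ t, |u t - v t| ≤ ε) :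
    |massDstar (toMul u) - massDstar (toMul v)| ≤ ε * Real.exp (R / 2) * (2 * R) := by
  rw [massDstar_toMul_eq_re, massDstar_toMul_eq_re, ← Complex.sub_re, ← weilMellin_ofReal_sub hu hv]
  refine (Complex.abs_re_le_norm _).trans (norm_weilMellin_ofReal_le hR ?_ hε hclose (by simp) (by simp))
  exact (tsupport_sub u v).trans (union_subset hsuppu hsuppv) |>.trans' (by
    intro x hx; simpa using hx)

/-- `ε`-continuity of the mass `d_u` in the window sup-norm. -/
theorem abs_massDu_toMul_sub_le {u v : ℝ → ℝ} (hu : IsWeilTest fun t ↦ (u t : ℂ))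
    (hv : IsWeilTest fun t ↦ (v t : ℂ)) {R ε : ℝ} (hR : 0 ≤ R) (hsuppu : tsupport u ⊆ Icc (-R) R)
    (hsuppv : tsupport v ⊆ Icc (-R) R) (hε : 0 ≤ ε) (hclose : ∀ t, |u t - v t| ≤ ε) :
    |massDu (toMul u) - massDu (toMul v)| ≤ ε * Real.exp (R / 2) * (2 * R) := by
  rw [massDu_toMul_eq_re, massDu_toMul_eq_re, ← Complex.sub_re, ← weilMellin_ofReal_sub hu hv]
  refine (Complex.abs_re_le_norm _).trans (norm_weilMellin_ofReal_le hR ?_ hε hclose (by simp) (by simp))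
  exact (tsupport_sub u v).trans (union_subset hsuppu hsuppv) |>.trans' (by
    intro x hx; simpa using hx)

end Summit.RiemannHypothesis.RiemannHypothesis.Theorems.MotivicDoor.AWS
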